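import Literature.AlgebraicGeometry.Resolution.CompositeValuations
import Mathlib.RingTheory.Valuation.ValuationSubring
import HarnessLib

/-!
# Level calculus for adapted charts, I: the dictionary between `O`, a coarsening `W` and `O/𝔪_W`

Crux `Valuative.LuAlphaPTorsor` (stmt-ResolutionOfSingularities-0641), line `pfaff-line-log-final-forms`,
lead seat c4 — the attack on the rank `≥ 2` Abhyankar core `stub_abhyankarHigherRankCore` by the
level-wise Perron monomialization (S3*). For valuation rings `O ≤ W` of `K`, the residue map
`π : W → κ(W)` and the residue valuation ring `Ō = O/𝔪_W ⊆ κ(W)` (`residueValuationSubring`,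
`CompositeValuations.lean`):

* `ap_valuation_lt_one_iff_forall` — with `W` cut out by Laurent monomials
  (`z ∈ W ↔ ∃ m, v z ≤ v(y^m)` over a set of admissible exponents closed under negation),
  `W.valuation z < 1 ↔ ∀ m, v z < v(y^m)`;
* `ap_residue_eq_zero_iff` — `π r = 0 ↔ W.valuation r < 1`;
* `ap_resval_le_iff` — for `W`-units `a, b ∈ O`: `Ō.v (π a) ≤ Ō.v (π b) ↔ v a ≤ v b`, with the
  `<` and `=` versions;
* `ap_residue_prod_zpow` — `π` of a Laurent monomial in `W`-units is the Laurent monomial of the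
  residues.

Everything [folklore] (composite valuations: Bourbaki, *Alg. Comm.* VI §4; Zariski–Samuel II, VI §10).
-/

set_option linter.dupNamespace false

open IsLocalRing

namespace Summit.ResolutionOfSingularities.ResolutionOfSingularities.Theorems.PfaffLine

open Literature.AlgebraicGeometry.Resolution

variable {K : Type} [Field K]

/-! ### Valuation comparisons in a valuation subring -/

/-- In a valuation subring `S`, `S.v a ≤ S.v b` iff `a / b ∈ S` (`b ≠ 0`). [folklore] -/
theorem ap_valuation_le_iff_div_mem (S : ValuationSubring K) {a b : K} (hb : b ≠ 0) :
    S.valuation a ≤ S.valuation b ↔ a / b ∈ S := by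
  rw [← S.valuation_le_one_iff, map_div₀, div_le_one₀ ((Valuation.pos_iff _).mpr hb)]

/-- In a valuation subring `S`, `S.v a < S.v b` iff `b / a ∉ S` or … : precisely, for `a, b ≠ 0`,
`S.v a < S.v b ↔ b / a ∉ S`. [folklore] -/
theorem ap_valuation_lt_iff_div_not_mem (S : ValuationSubring K) {a b : K} (ha : a ≠ 0) :
    S.valuation a < S.valuation b ↔ b / a ∉ S := by
  rw [← not_le, ap_valuation_le_iff_div_mem S ha]

/-- For `z ≠ 0`: `S.v z = 1` iff `z ∈ S` and `z⁻¹ ∈ S`. [folklore] -/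
theorem ap_valuation_eq_one_iff_mem_inv_mem (S : ValuationSubring K) {z : K} (hz0 : z ≠ 0) :
    S.valuation z = 1 ↔ z ∈ S ∧ z⁻¹ ∈ S := by
  constructor
  · intro h
    refine ⟨(S.valuation_le_one_iff z).mp h.le, (S.valuation_le_one_iff _).mp ?_⟩
    rw [map_inv₀, h, inv_one]
  · rintro ⟨hz, hzi⟩
    have h1 := (S.valuation_le_one_iff z).mpr hz
    have h2 := (S.valuation_le_one_iff _).mpr hzi
    rw [map_inv₀] at h2
    exact le_antisymm h1 ((inv_le_one₀ ((Valuation.pos_iff _).mpr hz0)).mp h2)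

/-! ### A coarsening cut out by Laurent monomials -/

section Cut

variable (O W : ValuationSubring K) {n : ℕ} (x : Fin n → K) (P : (Fin n → ℤ) → Prop)

/-- If `W` is cut out by the Laurent monomials `x^m`, `P m` (with `P 0` and `P` stable under
negation) — `z ∈ W ↔ ∃ m, P m ∧ v z ≤ v(x^m)` — then `W.v z < 1` iff `v z < v(x^m)` for EVERY
admissible `m`. [folklore] -/
theorem ap_valuation_lt_one_iff_forall (hx0 : ∀ i, x i ≠ 0) (hP0 : P 0)
    (hPneg : ∀ m, P m → P (-m))
    (hW : ∀ z : K, z ∈ W ↔ ∃ m : Fin n → ℤ, P m ∧ O.valuation z ≤ ∏ i, O.valuation (x i) ^ (m i))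
    (z : K) :
    W.valuation z < 1 ↔ ∀ m : Fin n → ℤ, P m → O.valuation z < ∏ i, O.valuation (x i) ^ (m i) := by
  have hvx0 : ∀ i, O.valuation (x i) ≠ 0 := fun i => (map_ne_zero _).mpr (hx0 i)
  have hpos : ∀ m : Fin n → ℤ, 0 < ∏ i, O.valuation (x i) ^ (m i) := fun m =>
    Finset.prod_pos fun i _ => zpow_pos (zero_lt_iff.mpr (hvx0 i)) _
  have hneg : ∀ m : Fin n → ℤ, (∏ i, O.valuation (x i) ^ ((-m) i)) = (∏ i, O.valuation (x i) ^ (m i))⁻¹ := by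
    intro m
    rw [← Finset.prod_inv_distrib]
    exact Finset.prod_congr rfl fun i _ => by rw [Pi.neg_apply, zpow_neg]
  constructor
  · intro hz m hm
    by_contra hle
    push Not at hle
    have hz0 : z ≠ 0 := by
      rintro rfl
      rw [map_zero] at hle
      exact absurd hle (not_le.mpr (hpos m))
    have hzW : z ∈ W := (W.valuation_le_one_iff z).mp hz.le
    have hziW : z⁻¹ ∈ W := by
      rw [hW]
      refine ⟨-m, hPneg m hm, ?_⟩
      rw [map_inv₀, hneg]
      exact (inv_le_inv₀ ((Valuation.pos_iff _).mpr hz0) (hpos m)).mpr hle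
    have h1 := (ap_valuation_eq_one_iff_mem_inv_mem W hz0).mpr ⟨hzW, hziW⟩
    exact hz.ne h1
  · intro h
    have hzW : z ∈ W := by
      rw [hW]
      refine ⟨0, hP0, ?_⟩
      exact (h 0 hP0).le
    have hle := (W.valuation_le_one_iff z).mpr hzW
    refine lt_of_le_of_ne hle fun h1 => ?_
    by_cases hz0 : z = 0
    · rw [hz0, map_zero] at h1; exact zero_ne_one h1
    obtain ⟨-, hzi⟩ := (ap_valuation_eq_one_iff_mem_inv_mem W hz0).mp h1
    obtain ⟨m, hm, hvm⟩ := (hW _).mp hzi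
    have hlt := h (-m) (hPneg m hm)
    rw [hneg] at hlt
    rw [map_inv₀] at hvm
    -- `v z < (∏)⁻¹ ≤ v z`
    have : (∏ i, O.valuation (x i) ^ (m i))⁻¹ ≤ O.valuation z := by
      rw [inv_le_comm₀ (hpos m) ((Valuation.pos_iff _).mpr hz0)]; exact hvm
    exact lt_irrefl _ (hlt.trans_le this)

end Cut

/-! ### Residues -/

/-- `π r = 0 ↔ W.v r < 1` for `r ∈ W`. [folklore] -/
theorem ap_residue_eq_zero_iff (W : ValuationSubring K) {r : K} (hr : r ∈ W) :
    residue W ⟨r, hr⟩ = 0 ↔ W.valuation r < 1 := by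
  rw [residue_eq_zero_iff, ValuationSubring.valuation_lt_one_iff]

/-- The residue of a `W`-unit is non-zero. [folklore] -/
theorem ap_residue_ne_zero_of_valuation_eq_one (W : ValuationSubring K) {r : K} (hr : r ∈ W)
    (hu : W.valuation r = 1) : residue W ⟨r, hr⟩ ≠ 0 := by
  rw [Ne, ap_residue_eq_zero_iff, hu]; exact lt_irrefl _

/-- Residue of an integer power of a `W`-unit (the power taken in `K`). [folklore] -/
theorem ap_residue_zpow (W : ValuationSubring K) {y : K} (hy : y ∈ W) (hyi : y⁻¹ ∈ W) (hy0 : y ≠ 0)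
    (m : ℤ) (hm : y ^ m ∈ W) : residue W ⟨y ^ m, hm⟩ = residue W ⟨y, hy⟩ ^ m := by
  rcases Int.eq_nat_or_neg m with ⟨N, rfl | rfl⟩
  · have : (⟨y ^ (N : ℤ), hm⟩ : W) = ⟨y, hy⟩ ^ N := Subtype.ext (by push_cast; rw [zpow_natCast])
    rw [this, map_pow, zpow_natCast]
  · have hm' : (y⁻¹) ^ N ∈ W := pow_mem hyi N
    have : (⟨y ^ (-(N : ℤ)), hm⟩ : W) = ⟨y⁻¹, hyi⟩ ^ N :=
      Subtype.ext (by push_cast; rw [zpow_neg, zpow_natCast, inv_pow])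
    rw [this, map_pow, residue_mk_inv W hy hyi hy0, zpow_neg, zpow_natCast, inv_pow]

/-- Residue of a Laurent monomial in `W`-units (the monomial taken in `K`). [folklore] -/
theorem ap_residue_prod_zpow (W : ValuationSubring K) {n : ℕ} (y : Fin n → K) (hy : ∀ i, y i ∈ W)
    (hyi : ∀ i, (y i)⁻¹ ∈ W) (hy0 : ∀ i, y i ≠ 0) (m : Fin n → ℤ)
    (hm : (∏ i, y i ^ (m i)) ∈ W) :
    residue W ⟨∏ i, y i ^ (m i), hm⟩ = ∏ i, residue W ⟨y i, hy i⟩ ^ (m i) := by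
  classical
  have hmem : ∀ i, y i ^ (m i) ∈ W := by
    intro i
    rcases Int.eq_nat_or_neg (m i) with ⟨N, h | h⟩
    · rw [h, zpow_natCast]; exact pow_mem (hy i) N
    · rw [h, zpow_neg, zpow_natCast, ← inv_pow]; exact pow_mem (hyi i) N
  have : (⟨∏ i, y i ^ (m i), hm⟩ : W) = ∏ i, (⟨y i ^ (m i), hmem i⟩ : W) :=
    Subtype.ext (by push_cast; rfl)
  rw [this, map_prod]
  exact Finset.prod_congr rfl fun i _ => ap_residue_zpow W (hy i) (hyi i) (hy0 i) (m i) (hmem i)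

/-! ### The residue valuation ring `O/𝔪_W` -/

/-- **Comparison of residual values = comparison of values** for `a ∈ W` and a `W`-UNIT `b`:
`Ō.v (π a) ≤ Ō.v (π b) ↔ v a ≤ v b` (`Ō = O/𝔪_W`). [folklore] -/
theorem ap_resval_le_iff : ∀ {K : Type} [Field K] (O W : ValuationSubring K) (hOW : O ≤ W) {a b : K} (ha : a ∈ W) (hb : b ∈ W), W.valuation b = 1 → ((Literature.AlgebraicGeometry.Resolution.residueValuationSubring O W hOW).valuation (IsLocalRing.residue W ⟨a, ha⟩) ≤ (Literature.AlgebraicGeometry.Resolution.residueValuationSubring O W hOW).valuation (IsLocalRing.residue W ⟨b, hb⟩) ↔ O.valuation a ≤ O.valuation b) := by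
  intro K _ O W hOW a b ha hb hbu
  have hb0 : b ≠ 0 := by rintro rfl; rw [map_zero] at hbu; exact zero_ne_one hbu
  have hbi : b⁻¹ ∈ W := ((ap_valuation_eq_one_iff_mem_inv_mem W hb0).mp hbu).2
  have hπb : residue W ⟨b, hb⟩ ≠ 0 := ap_residue_ne_zero_of_valuation_eq_one W hb hbu
  rw [ap_valuation_le_iff_div_mem _ hπb, ap_valuation_le_iff_div_mem _ hb0]
  have hab : a / b ∈ W := by rw [div_eq_mul_inv]; exact mul_mem ha hbi
  have hdiv : residue W ⟨a, ha⟩ / residue W ⟨b, hb⟩ = residue W ⟨a / b, hab⟩ := by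
    rw [div_eq_mul_inv, ← residue_mk_inv W hb hbi hb0, ← map_mul]
    congr 1
    exact Subtype.ext (by push_cast; rw [div_eq_mul_inv])
  rw [hdiv, residue_mem_residueValuationSubring_iff]

/-- Strict version for a `W`-unit `a` and `b ∈ W`: `Ō.v (π a) < Ō.v (π b) ↔ v a < v b`. [folklore] -/
theorem ap_resval_lt_iff (O W : ValuationSubring K) (hOW : O ≤ W) {a b : K} (ha : a ∈ W) (hb : b ∈ W)
    (hau : W.valuation a = 1) :
    (residueValuationSubring O W hOW).valuation (residue W ⟨a, ha⟩) <
        (residueValuationSubring O W hOW).valuation (residue W ⟨b, hb⟩) ↔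
      O.valuation a < O.valuation b := by
  rw [← not_le, ← not_le, ap_resval_le_iff O W hOW hb ha hau]

/-- Equality version for two `W`-units `a, b`. [folklore] -/
theorem ap_resval_eq_iff (O W : ValuationSubring K) (hOW : O ≤ W) {a b : K} (ha : a ∈ W) (hb : b ∈ W)
    (hau : W.valuation a = 1) (hbu : W.valuation b = 1) :
    (residueValuationSubring O W hOW).valuation (residue W ⟨a, ha⟩) =
        (residueValuationSubring O W hOW).valuation (residue W ⟨b, hb⟩) ↔
      O.valuation a = O.valuation b := by
  rw [le_antisymm_iff, le_antisymm_iff, ap_resval_le_iff O W hOW ha hb hbu,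
    ap_resval_le_iff O W hOW hb ha hau]

/-- For `a ∈ W`: `Ō.v (π a) < 1 ↔ v a < 1` provided `a` is a `W`-unit; and `Ō.v (π a) ≤ 1 ↔ v a ≤ 1`
for every `a ∈ W`. [folklore] -/
theorem ap_resval_lt_one_iff (O W : ValuationSubring K) (hOW : O ≤ W) {a : K} (ha : a ∈ W)
    (hau : W.valuation a = 1) :
    (residueValuationSubring O W hOW).valuation (residue W ⟨a, ha⟩) < 1 ↔ O.valuation a < 1 := by
  have h := ap_resval_lt_iff O W hOW ha W.one_mem hau
  have h1 : (residue W ⟨(1 : K), W.one_mem⟩) = 1 := by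
    rw [← map_one (residue W)]; rfl
  rw [h1, map_one, map_one] at h
  exact h

/-- For `a ∈ W`: `Ō.v (π a) ≤ 1 ↔ v a ≤ 1` (i.e. `π a ∈ Ō ↔ a ∈ O`). [folklore] -/
theorem ap_resval_le_one_iff (O W : ValuationSubring K) (hOW : O ≤ W) {a : K} (ha : a ∈ W) :
    (residueValuationSubring O W hOW).valuation (residue W ⟨a, ha⟩) ≤ 1 ↔ O.valuation a ≤ 1 := by
  have h := ap_resval_le_iff O W hOW ha W.one_mem (by rw [map_one])
  have h1 : (residue W ⟨(1 : K), W.one_mem⟩) = 1 := by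
    rw [← map_one (residue W)]; rfl
  rw [h1, map_one, map_one] at h
  exact h

end Summit.ResolutionOfSingularities.ResolutionOfSingularities.Theorems.PfaffLine
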